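/-
Copyright (c) 2026 the pub-hodgecm-mathlib formalisation cell (harness21).  Prover seat hodgecm-mathlib-K2E1-p10 (g2), Track B ∕ K2-LIT (build stream 29),
h413 = `stmt-HodgeConjecture-24833`, route of record `HCCMUnconditional`, campaigns «EIS-R7-BL-SPH-2∕3»; dealer K2E1-plan (g6) deal (76) 2026-09-04T10:29:23Z
(«THEN the two ABSOLUTE EDITIONS `Theorems/K2E1SphericalEisensteinMeromorphicAbsoluteCM.lean` … with EVERY structural binder INHABITED inside the proof»).
-/
import Summits.HodgeConjecture.HodgeConjecture.Theorems.K2E1SphericalEisensteinMeromorphicU2              -- ★ p859271∕p859352∕p859370 (K2E3-p12): closer₂ ED. 3 `sphericalEisenstein_meromorphic_cm_two` (letter-free)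
import Summits.HodgeConjecture.HodgeConjecture.Theorems.K2E1SphericalEisensteinMeromorphicU3              -- ★ p859360 + ED. 2 (K2E1-p09 ∕ K2E1-p13): closer₃ `sphericalEisenstein_meromorphic_cm_three` (letter-free)
import Summits.HodgeConjecture.HodgeConjecture.Theorems.K2E1SphericalEisensteinStructuralDataCMTwo        -- ★∕📤 p859399 (this seat): `(ν, 𝓕)`, `(νG, β, μZ)` inhabited at `N = 2`
import Summits.HodgeConjecture.HodgeConjecture.Theorems.K2E1SphericalEisensteinStructuralDataCMThree      -- ★ p859380 (this seat): `(ν, 𝓕)`, `(νG, β, μZ)` inhabited at `N = 3`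
import Literature.NumberTheory.Automorphic.UnitaryGroupAutomorphicMeasure                                -- ★ Borel–Harish-Chandra: `exists_isAutomorphicMeasure_cmDatum_of_isHermitian`
import Literature.NumberTheory.Automorphic.UnitaryGroupQuasiSplitCMDatum                                 -- ★ `quasiSplit_eq_cmDatum` (rfl), `cmConj_antidiagonal_transpose`, `isUnit_det_antidiagonal_over`
import HarnessLib

/-!
# h413 ∕ Track B «K2-LIT», campaigns «EIS-R7-BL-SPH-2∕3» — `K2E1SphericalEisensteinMeromorphicAbsoluteCM`: THE ABSOLUTE EDITIONS OF THE BERNSTEIN–LAPID CLOSERS —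
# THE SPHERICAL BOREL EISENSTEIN SERIES OF `U(1,1)_{L∕L⁺}` AND OF `U(2,1)_{L∕L⁺}` ARE MEROMORPHIC ON ALL OF `ℂ`, WITH NO LETTER AND NO STRUCTURAL BINDER LEFT

Cell `pub/hodgecm-mathlib`, crux h413 = `stmt-HodgeConjecture-24833`, route of record `HCCMUnconditional`; chair K2-lead (g1), dealer K2E1-plan (g6) deal (76) 2026-09-04T10:29:23Z.  THEOREMS
ONLY (no `def`, no `instance`, no notation, no named-fact hypothesis, no `sorry`); lane `--supports stmt-HodgeConjecture-24833 --as helper` (count-neutral).  Closes no socket.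

THE POINT.  The letter-free closers ★ `K2E1SphericalEisensteinMeromorphicU2.sphericalEisenstein_meromorphic_cm_two` (ED. 3) and ★ `K2E1SphericalEisensteinMeromorphicU3.sphericalEisenstein_meromorphic_cm_three`
(ED. 2) conclude `∃ Ec, (∀ g, MeromorphicOn (Ec · g) univ) ∧ ∀ z, σ₀ < Re z → Ec z = E(φ₀H^z)` (`σ₀ = 1` resp. `2`) under STRUCTURAL binders only: the automorphic measure `μ`, a Haar
measure `νG` of `G(𝔸)` (inversion-invariant, s-finite), a Haar measure `ν` of the radical `N(𝔸)` (right- and inversion-invariant) with a relatively compact fundamental domain `𝓕` of `N(F)` of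
non-zero measure, a covering weight `β` of `B(F)♯` and its unfolded s-finite measure `μZ`.  The conclusion mentions none of them — the Eisenstein series `eisensteinSeriesU (flatSectionU φ₀ z)`
is a sum over `B(F)∖G(F)` and carries no measure — so they are inhabited INSIDE the proof: `(νG, β, μZ)` and `(ν, 𝓕)` by ★ `K2E1SphericalEisensteinStructuralDataCMTwo∕…Three`, and, for the
fully absolute editions, the Borel structure on `G(𝔸)` by `borel` and the automorphic measure `μ` by Borel–Harish-Chandra finiteness ★ `exists_isAutomorphicMeasure_cmDatum_of_isHermitian`
(`quasiSplit L⁺ L c̄ N = cmDatum L N Φ_N` is `rfl`, `Φ_N` hermitian with unit determinant ★).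

* §1 `U(1,1)_{L∕L⁺}`: **`sphericalEisenstein_meromorphic_cm_two_abs (μ) [IsAutomorphicMeasure μ] (φ₀)`** (the dealt head: only the automorphic measure displayed) and
  **`sphericalEisenstein_meromorphic_cm_two_absolute (φ₀)`** (nothing displayed but the CM field and `φ₀`).
* §2 `U(2,1)_{L∕L⁺}`: **`sphericalEisenstein_meromorphic_cm_three_abs (μ) [IsAutomorphicMeasure μ] (φ₀)`** and **`sphericalEisenstein_meromorphic_cm_three_absolute (φ₀)`**.

MILESTONE LABELS: «(R7-sph)₂ ABSOLUTE», «(R7-sph)₃ ABSOLUTE» — citation-grade heads for the TABLE and the capstone.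
HONEST LABEL: HC_CM is proved only modulo the 7 printed citations (2 remaining named inputs: hLiu418 = `stmt-HodgeConjecture-24832`, h413 = `stmt-HodgeConjecture-24833`) until rung 0
closes; this file asserts no named fact and closes no socket.
References: [BernsteinLapid2019] J. Bernstein, E. Lapid, *On the meromorphic continuation of Eisenstein series*, arXiv:1911.02342 (JAMS 37 (2024), doi:10.1090/jams/1020), Thm 2.3,
§2.4, §4 Claims 1–5 (pp. 9–10); [Langlands1976] R. P. Langlands, *On the Functional Equations Satisfied by Eisenstein Series*, LNM 544, §7; [MoeglinWaldspurger1995] C. Mœglin,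
J.-L. Waldspurger, *Spectral Decomposition and Eisenstein Series*, IV.1.8–IV.1.10; [Borel1963] A. Borel, *Some finiteness properties of adele groups over number fields*, Publ. Math.
IHÉS 16, Thm. 5.8.
-/

set_option autoImplicit false
-- the mandated namespace repeats `HodgeConjecture.HodgeConjecture`, as in every `Theorems/*.lean` of this sub-problem
set_option linter.dupNamespace false

noncomputable section

open MeasureTheory MeasureTheory.Measure Set NumberField Filter Topology
open scoped NNReal ENNReal
open Literature.MeasureTheory.Group Literature.NumberTheory.Automorphic Literature.NumberTheory.Automorphic.UnitaryGroup AdelicGroupData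
open Summit.HodgeConjecture.HodgeConjecture.Cruxes.H413.K2E1BorelEisensteinU
open Summit.HodgeConjecture.HodgeConjecture.Cruxes.H413.K2E1BLBorelSpacesU2Defs
open Summit.HodgeConjecture.HodgeConjecture.Cruxes.H413.K2E1SphericalEisensteinMeromorphicU2 (sphericalEisenstein_meromorphic_cm_two)
open Summit.HodgeConjecture.HodgeConjecture.Cruxes.H413.K2E1SphericalEisensteinMeromorphicU3 (sphericalEisenstein_meromorphic_cm_three)
open Summit.HodgeConjecture.HodgeConjecture.Cruxes.H413.K2E1SphericalEisensteinStructuralDataCMTwo (exists_unipotent_haar_fundamentalDomain_cm_two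
  exists_haar_coveringWeight_unfoldedMeasure_cm_two)
open Summit.HodgeConjecture.HodgeConjecture.Cruxes.H413.K2E1SphericalEisensteinStructuralDataCMThree (exists_unipotent_haar_fundamentalDomain_cm_three
  exists_haar_coveringWeight_unfoldedMeasure_cm_three)

namespace Summit.HodgeConjecture.HodgeConjecture.Cruxes.H413.K2E1SphericalEisensteinMeromorphicAbsoluteCM

/-! ## §1 `U(1,1)_{L∕L⁺}` -/

section Two

variable (L : Type) [Field L] [NumberField L] [IsCMField L]
  [MeasurableSpace (quasiSplit (↥(maximalRealSubfield L)) L (IsCMField.complexConj L) 2).Adelic] [BorelSpace (quasiSplit (↥(maximalRealSubfield L)) L (IsCMField.complexConj L) 2).Adelic]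

/-- **«(R7-sph)₂ ABSOLUTE»: THE SPHERICAL BOREL EISENSTEIN SERIES OF `U(1,1)_{L∕L⁺}` IS MEROMORPHIC ON ALL OF `ℂ`** — for every automorphic measure `μ` and every `φ₀ : ℂ` there is
`Ec : ℂ → (G(𝔸) → ℂ)` with `z ↦ Ec z g` meromorphic on `ℂ` for every `g` and `Ec z = E(φ₀H^z)` for `1 < Re z`; ★ closer ED. 3 `sphericalEisenstein_meromorphic_cm_two` with its structural binders
`(νG, β, μZ)` ∕ `(ν, 𝓕)` inhabited by ★ `exists_haar_coveringWeight_unfoldedMeasure_cm_two` ∕ ★ `exists_unipotent_haar_fundamentalDomain_cm_two`.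
[cite: BernsteinLapid2019, Thm 2.3, §2.4 and §4 Claims 1–5 (pp. 9–10)] [cite: Langlands1976, §7] [cite: MoeglinWaldspurger1995, IV.1.8–IV.1.10] -/
theorem sphericalEisenstein_meromorphic_cm_two_abs
    (μ : Measure (quasiSplit (↥(maximalRealSubfield L)) L (IsCMField.complexConj L) 2).automorphicQuotient) [(quasiSplit (↥(maximalRealSubfield L)) L (IsCMField.complexConj L) 2).IsAutomorphicMeasure μ]
    (φ₀ : ℂ) :
    ∃ Ec : ℂ → (quasiSplit (↥(maximalRealSubfield L)) L (IsCMField.complexConj L) 2).Adelic → ℂ,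
      (∀ g, MeromorphicOn (fun z => Ec z g) univ) ∧
      ∀ z : ℂ, 1 < z.re → Ec z = eisensteinSeriesU (flatSectionU (fun _ : (quasiSplit (↥(maximalRealSubfield L)) L (IsCMField.complexConj L) 2).Adelic => φ₀) z) := by
  obtain ⟨νG, β, μZ, hνG, _, hνGi, hνGs, hβ, hμZs, hμZ⟩ := exists_haar_coveringWeight_unfoldedMeasure_cm_two L
  obtain ⟨ν, 𝓕, hν, hνr, hνi, h𝓕N, h𝓕c, h𝓕₀, -⟩ := exists_unipotent_haar_fundamentalDomain_cm_two L
  haveI := hνG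
  haveI := hνGi
  haveI := hνGs
  haveI := hν
  haveI := hνr
  haveI := hνi
  haveI := hμZs
  exact sphericalEisenstein_meromorphic_cm_two L μ νG ν h𝓕N h𝓕c h𝓕₀ hβ hμZ φ₀

end Two

section TwoAbsolute

variable (L : Type) [Field L] [NumberField L] [IsCMField L]

/-- **«(R7-sph)₂ ABSOLUTE», NOTHING DISPLAYED**: for every CM field `L` and every `φ₀ : ℂ` the spherical Borel Eisenstein series `E(φ₀H^z)` of `U(1,1)_{L∕L⁺}` has a whole-plane meromorphic
continuation in `z` for every `g ∈ G(𝔸)` — §1 with the Borel structure of `G(𝔸)` chosen by `borel` and the automorphic measure supplied by Borel–Harish-Chandra finiteness ★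
`exists_isAutomorphicMeasure_cmDatum_of_isHermitian` (`quasiSplit L⁺ L c̄ 2 = cmDatum L 2 Φ₂` by `rfl`; `Φ₂` hermitian ★ `cmConj_antidiagonal_transpose`, `det Φ₂` a unit ★
`isUnit_det_antidiagonal_over`). [cite: BernsteinLapid2019, Thm 2.3, §2.4 and §4 Claims 1–5 (pp. 9–10)] [cite: Borel1963, Thm. 5.8] [cite: MoeglinWaldspurger1995, IV.1.8–IV.1.10] -/
theorem sphericalEisenstein_meromorphic_cm_two_absolute (φ₀ : ℂ) :
    ∃ Ec : ℂ → (quasiSplit (↥(maximalRealSubfield L)) L (IsCMField.complexConj L) 2).Adelic → ℂ,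
      (∀ g, MeromorphicOn (fun z => Ec z g) univ) ∧
      ∀ z : ℂ, 1 < z.re → Ec z = eisensteinSeriesU (flatSectionU (fun _ : (quasiSplit (↥(maximalRealSubfield L)) L (IsCMField.complexConj L) 2).Adelic => φ₀) z) := by
  letI : MeasurableSpace (quasiSplit (↥(maximalRealSubfield L)) L (IsCMField.complexConj L) 2).Adelic := borel _
  haveI : BorelSpace (quasiSplit (↥(maximalRealSubfield L)) L (IsCMField.complexConj L) 2).Adelic := ⟨rfl⟩
  obtain ⟨μ, hμ⟩ := exists_isAutomorphicMeasure_cmDatum_of_isHermitian L 2 ((StdForm.antidiagonal 2).over L)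
    (cmConj_antidiagonal_transpose (L := L) (N := 2)) (isUnit_det_antidiagonal_over (L := L) (N := 2)).ne_zero
  haveI : (quasiSplit (↥(maximalRealSubfield L)) L (IsCMField.complexConj L) 2).IsAutomorphicMeasure μ := hμ
  exact sphericalEisenstein_meromorphic_cm_two_abs L μ φ₀

end TwoAbsolute

/-! ## §2 `U(2,1)_{L∕L⁺}` -/

section Three

variable (L : Type) [Field L] [NumberField L] [IsCMField L]
  [MeasurableSpace (quasiSplit (↥(maximalRealSubfield L)) L (IsCMField.complexConj L) 3).Adelic] [BorelSpace (quasiSplit (↥(maximalRealSubfield L)) L (IsCMField.complexConj L) 3).Adelic]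

/-- **«(R7-sph)₃ ABSOLUTE»: THE SPHERICAL BOREL EISENSTEIN SERIES OF `U(2,1)_{L∕L⁺}` IS MEROMORPHIC ON ALL OF `ℂ`** — for every automorphic measure `μ` and every `φ₀ : ℂ` there is
`Ec : ℂ → (G(𝔸) → ℂ)` with `z ↦ Ec z g` meromorphic on `ℂ` for every `g` and `Ec z = E(φ₀H^z)` for `2 < Re z`; ★ closer₃ ED. 2 `sphericalEisenstein_meromorphic_cm_three` with its structural
binders `(νG, β, μZ)` ∕ `(ν, 𝓕)` (Heisenberg radical, Tate–Rogawski domain) inhabited by ★ `exists_haar_coveringWeight_unfoldedMeasure_cm_three` ∕ ★ `exists_unipotent_haar_fundamentalDomain_cm_three`.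
[cite: BernsteinLapid2019, Thm 2.3, §2.4 and §4 Claims 1–5 (pp. 9–10)] [cite: Langlands1976, §7] [cite: MoeglinWaldspurger1995, IV.1.8–IV.1.10] -/
theorem sphericalEisenstein_meromorphic_cm_three_abs
    (μ : Measure (quasiSplit (↥(maximalRealSubfield L)) L (IsCMField.complexConj L) 3).automorphicQuotient) [(quasiSplit (↥(maximalRealSubfield L)) L (IsCMField.complexConj L) 3).IsAutomorphicMeasure μ]
    (φ₀ : ℂ) :
    ∃ Ec : ℂ → (quasiSplit (↥(maximalRealSubfield L)) L (IsCMField.complexConj L) 3).Adelic → ℂ,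
      (∀ g, MeromorphicOn (fun z => Ec z g) univ) ∧
      ∀ z : ℂ, 2 < z.re → Ec z = eisensteinSeriesU (flatSectionU (fun _ : (quasiSplit (↥(maximalRealSubfield L)) L (IsCMField.complexConj L) 3).Adelic => φ₀) z) := by
  obtain ⟨νG, β, μZ, hνG, _, hνGi, hνGs, hβ, hμZs, hμZ⟩ := exists_haar_coveringWeight_unfoldedMeasure_cm_three L
  obtain ⟨ν, 𝓕, hν, hνr, hνi, h𝓕N, h𝓕c, h𝓕₀, -⟩ := exists_unipotent_haar_fundamentalDomain_cm_three L
  haveI := hνG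
  haveI := hνGi
  haveI := hνGs
  haveI := hν
  haveI := hνr
  haveI := hνi
  haveI := hμZs
  exact sphericalEisenstein_meromorphic_cm_three L μ νG ν h𝓕N h𝓕c h𝓕₀ hβ hμZ φ₀

end Three

section ThreeAbsolute

variable (L : Type) [Field L] [NumberField L] [IsCMField L]

/-- **«(R7-sph)₃ ABSOLUTE», NOTHING DISPLAYED**: for every CM field `L` and every `φ₀ : ℂ` the spherical Borel Eisenstein series `E(φ₀H^z)` of `U(2,1)_{L∕L⁺}` has a whole-plane meromorphic
continuation in `z` for every `g ∈ G(𝔸)` — §2 with the Borel structure of `G(𝔸)` chosen by `borel` and the automorphic measure supplied by ★ `exists_isAutomorphicMeasure_cmDatum_of_isHermitian`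
(`quasiSplit L⁺ L c̄ 3 = cmDatum L 3 Φ₃` by `rfl`). [cite: BernsteinLapid2019, Thm 2.3, §2.4 and §4 Claims 1–5 (pp. 9–10)] [cite: Borel1963, Thm. 5.8] [cite: MoeglinWaldspurger1995, IV.1.8–IV.1.10] -/
theorem sphericalEisenstein_meromorphic_cm_three_absolute (φ₀ : ℂ) :
    ∃ Ec : ℂ → (quasiSplit (↥(maximalRealSubfield L)) L (IsCMField.complexConj L) 3).Adelic → ℂ,
      (∀ g, MeromorphicOn (fun z => Ec z g) univ) ∧
      ∀ z : ℂ, 2 < z.re → Ec z = eisensteinSeriesU (flatSectionU (fun _ : (quasiSplit (↥(maximalRealSubfield L)) L (IsCMField.complexConj L) 3).Adelic => φ₀) z) := by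
  letI : MeasurableSpace (quasiSplit (↥(maximalRealSubfield L)) L (IsCMField.complexConj L) 3).Adelic := borel _
  haveI : BorelSpace (quasiSplit (↥(maximalRealSubfield L)) L (IsCMField.complexConj L) 3).Adelic := ⟨rfl⟩
  obtain ⟨μ, hμ⟩ := exists_isAutomorphicMeasure_cmDatum_of_isHermitian L 3 ((StdForm.antidiagonal 3).over L)
    (cmConj_antidiagonal_transpose (L := L) (N := 3)) (isUnit_det_antidiagonal_over (L := L) (N := 3)).ne_zero
  haveI : (quasiSplit (↥(maximalRealSubfield L)) L (IsCMField.complexConj L) 3).IsAutomorphicMeasure μ := hμ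
  exact sphericalEisenstein_meromorphic_cm_three_abs L μ φ₀

end ThreeAbsolute

end Summit.HodgeConjecture.HodgeConjecture.Cruxes.H413.K2E1SphericalEisensteinMeromorphicAbsoluteCM

end
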